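import Summits.HodgeConjecture.HodgeConjecture.Theorems.NikulinTwinTransportRealMultiplicationAnchorOfAlgebraic
import Literature.AlgebraicGeometry.Surfaces.K3HodgeTypesHolds
import Literature.AlgebraicGeometry.Surfaces.K3LatticeInvariants
import Literature.AlgebraicGeometry.HodgeTheory.SupportedClassesHodgeConiveauProofs
import Literature.AlgebraicGeometry.HodgeTheory.GysinKernelSplit
import Literature.AlgebraicGeometry.HodgeTheory.ComplexConjugationHolds
import Literature.NumberTheory.Transcendental.DeRhamTheoremMultiplicative

/-!
# Line `Sketch` (dihedral Hecke octagon) — skeleton for the crux `TwinTransportRMPicardTwo`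
# (stmt-HodgeConjecture-15067), leads prover-line-stmt-HodgeConjecture-15067-0 (cycles 1–2) and -c1-0

The line (idea card `dihedral-hecke-octagon`, ideator Sketch `IdeatorR1K1Sketch.lean`) delivers the
crux through the SELF-anchor `S″ := S`: real multiplication by `√2` on `T(S)` is made ALGEBRAIC by a
Hecke correspondence `x ↦ π₊ σ^* π^* x` presented on a smooth projective cover `π : W ⟶ S` carrying an
automorphism `σ` with `σ⁴ = -1` on `π^* T(S)` (`√2 = ζ₈ + ζ₈⁻¹`; the `D₈`-closure of an octagonal
cover, or — degenerate case `W = S`, `π = 𝟙` — a purely non-symplectic automorphism of order `8`).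

Typed decomposition — seven stubs over the line's life; this file keeps only the three currently
registered (`stub_k3Facts`, `stub_octagonalPresentation`, `stub_anchor_of_presentation`; `sorry` in the
first two and, until its helper lands, in the third), the four landed ones being tree theorems:

* `stub_pushPull_spec` — LANDED (`Theorems/NikulinTwinTransportTwinTransportRMPicardTwoStubPushPullSpec`):
  push–pull operators `c • f₊ g^* + c • f₊ g'^*` through a smooth projective surface `W` are actions of
  ALGEBRAIC self-correspondences of `S`, preserve Hodge types, Néron–Severi classes (granted `g`, `g'`
  surjective whenever `f` is) and — once `c • f₊` is rationally normalised — rational classes.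
* `stub_hecke_algebra` — LANDED (`…StubHeckeAlgebra`): the dihedral Hecke identity in Gysin calculus,
  `T = c π₊ (σ^* + σ'^*) π^*` is cup-self-adjoint and `T (T x) = 2 x` wherever `σ^{*4} π^* x = -π^* x`,
  granted transfer and `c π₊ π^* = 1`.
* `stub_rm_of_hecke` — LANDED (`…StubRmOfHecke`): the Néron–Severi correction `e' = T - T ∘ π_N` is a
  real multiplication in the route's sense and is algebraic.
* `stub_k3Facts` — the named-fact debt AT LEAF LEVEL (lead c1, cycle 1, after the wave-1 census): the
  four unproved Literature leaves `K3_finrank_complexBetti_two` (`b₂ = 22`), `K3_even_intersectionForm`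
  (Wu), `K3_exists_orientation_signature_hodgeRiemann_ample` (orientation, index `-16`, Hodge–Riemann,
  ample class) and `Deligne1974_ker_pullback_eq_ker_pullback_resolution` (Hodge III Prop. 8.2.7), from
  which the composition re-derives `Huybrechts_K3_marking_exists` and
  `Grothendieck1969_supportedClasses_le_hodgeConiveau` with every other input discharged
  (`Huybrechts_K3_marking_exists_holds_of`, `Grothendieck1969_supportedClasses_le_hodgeConiveau_of_deligne`).
  Expected `stub-blocked` = debt by name.
* `stub_hodgeIndex_of_eBlock` — LANDED (lead c1, cycle 1; p104257,
  `…TwinTransportRMPicardTwoHodgeIndexOfEBlock`): the first skeleton's hypothesis `hodgeIndex_surface S`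
  is a theorem under the crux's own hypotheses (Picard rank two + the `e`-block).
* `stub_octagonalPresentation` — THE HEART (lead's stub, conjecture C⁺ of the card): every projective K3
  surface of Picard rank `2` with real multiplication by `√2` admits an octagonal presentation
  `(W, π, σ, σ', c)`.  Open (van Geemen–Schütt 2023 Rem. 4.9: no cycle known on the maximal RM-`√2`
  families); true at the `ζ₈`-CM members (`W = S`, `σ = f` of order `8`, seat …-NikulinTwinTransport-1's
  `rmAnchor_of_swapAutomorphism`).  Lead c1 finding (Negative-notes/biregular-dihedral-towers.md): the
  card's own mechanism — a `D₈`-tower `S̃ → S → S/ι → (S/ι)/j → R` with `j` BIREGULAR on `S/ι` — does not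
  exist at Picard rank two (`p_g(S̃/ŝ) ≥ 2` for the swap `ŝ`, whereas `σ` would force `S̃/ŝ ≅ S`);
  presentations with `j` a genuine Cremona involution, or non-dihedral ones, remain open.

* `stub_anchor_of_presentation` — THE THEOREM OF THE LINE (lead c1, cycle 1; helper
  `…TwinTransportRMPicardTwoAnchorOfPresentation`, proposed): the four landed stubs composed with
  `rmAnchor_at_of_realMultiplication_algebraic_at` (seat 13679-1) — every octagonally presented
  Picard-rank-2 RM K3 satisfies the conclusion of the crux, granted the two named facts.

`TwinTransportRMPicardTwo_of` is now one line of glue: leaves ⇒ facts, heart ⇒ presentation, theorem of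
the line ⇒ the crux BY NAME; `…_skeleton` is the crux modulo exactly the registered stubs.
-/

noncomputable section

set_option linter.dupNamespace false

namespace Summit.HodgeConjecture.HodgeConjecture.Cruxes.TwinTransportRMPicardTwo.Sketch

open scoped Manifold
open CategoryTheory MonoidalCategory SemiCartesianMonoidalCategory
open Literature.AlgebraicGeometry.Motives Literature.AlgebraicGeometry.HodgeTheory
open Literature.AlgebraicGeometry.Surfaces Literature.Geometry.Kaehler
open Literature.AlgebraicTopology.SingularHomology
open Summit.HodgeConjecture.HodgeConjecture.Theorems.NikulinTwinTransport

/-! ## Registered stubs (`sorry` lives only here; the landed stubs 1–3 and 4b are tree theorems) -/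

/-- **Stub 4 · the named-fact debt of the composition, AT LEAF LEVEL** (unproved Literature facts; a
stub so that the skeleton's hypotheses are obligations by name — expected `stub-blocked`). Reshaped
twice by lead c1 (cycle 1): the first skeleton's conjunct `∀ X, hodgeIndex_surface X` is gone
(`stub_hodgeIndex_of_eBlock` proves `hodgeIndex_surface S` from the crux hypotheses), and the two facts
the landed theorems consume — `Huybrechts_K3_marking_exists` (markings) and
`Grothendieck1969_supportedClasses_le_hodgeConiveau` (coniveau inclusion) — are replaced by the FOUR
unproved leaves they reduce to in the tree (wave-1 census, kernel-checked): `b₂(K3) = 22`, evenness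
of the intersection form (Wu), the orientation / signature `-16` / Hodge–Riemann / ample-class
package, and Deligne's Hodge III Prop. 8.2.7; the composition re-derives the two facts through
`Huybrechts_K3_marking_exists_holds_of` and `Grothendieck1969_supportedClasses_le_hodgeConiveau_of_deligne`
with every other input discharged. [Huybrechts2016K3 Ch. 1 Prop. 3.5, §3.3; DeligneHodgeIII1974
Prop. 8.2.7, Cor. 8.2.8; Grothendieck1969 p. 300] -/
theorem stub_k3Facts : K3_finrank_complexBetti_two ∧ K3_even_intersectionForm ∧
    K3_exists_orientation_signature_hodgeRiemann_ample ∧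
    Deligne1974_ker_pullback_eq_ker_pullback_resolution := by
  sorry

/-- **Stub 5 · THE HEART: octagonal presentations exist** (conjecture C⁺ of the card
`dihedral-hecke-octagon`; lead's stub).  Every projective K3 surface `S` of Picard rank `2` carrying a
rational, type-preserving `e` killing `NS` with `e (e x) = 2 x` on `NS^⊥` admits a smooth projective
surface `W`, a morphism `π : W ⟶ S`, automorphisms `σ, σ'` of `W` inverse to each other and trivial on
`H⁴(W(ℂ); ℂ)`, and a scalar `c` (the rational normalisation of `π₊` divided by `deg π`) with:
transfer `π^* (c π₊ (σ^* + σ'^*) π^* x) = (σ^* + σ'^*) π^* x`, `c π₊ π^* = 1`, `c π₊` rational, and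
`σ^{*4} = -1` on `π^* (NS^⊥)`.  Instances: the `ζ₈`-CM members (`W = S`, `π = 𝟙`, `c = 1`, `σ = f` a
purely non-symplectic automorphism of order `8`); conjecturally the `D₈`-closures of octagonal covers
of every member of the maximal RM-`√2` families (van Geemen–Schütt 2023 §4.7–4.9 for odd order).
OPEN. [VanGeemenSchuett2023 Thm. 3.10, §4.7–4.9, Prop. 6.2] -/
theorem stub_octagonalPresentation : ∀ (μ : OrientationFamily), μ.HasPoincareDuality →
    ∀ (S : SchemeOver ℂ)
      (hS : (IsSmoothProjective 2 S ∧ Subsingleton (structureSheafCohomology S.left 1) ∧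
        ∃ (A : HodgeModel 2 S) (η : MForm 𝓘(ℝ, A.model) A.carrier ℂ 2),
          IsHolomorphicInCharts η ∧ ∀ x, η x ≠ 0))
      (p : complexBetti S (2 * 2)),
      (IsIntegralClass p ∧ ∀ q : complexBetti S (2 * 2), IsIntegralClass q → ∃ n : ℤ, q = n • p) →
      Module.finrank ℂ ↥(algebraicClasses S 1) = 2 →
      ∀ (e : complexBetti S (2 * 1) →ₗ[ℂ] complexBetti S (2 * 1)),
      (∀ x, IsRationalClass x → IsRationalClass (e x)) →
      (∀ (i j : ℕ) x, IsOfHodgeType 2 S (2 * 1) i j x → IsOfHodgeType 2 S (2 * 1) i j (e x)) →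
      (∀ d ∈ algebraicClasses S 1, e d = 0) →
      (∀ x : complexBetti S (2 * 1),
          (∀ d ∈ algebraicClasses S 1, cupProduct (rfl : 2 * 1 + 2 * 1 = 2 * 2) x d = 0) →
            e (e x) = (2 : ℂ) • x) →
      ∃ (W : SchemeOver ℂ) (hW : IsSmoothProjective 2 W) (π : W ⟶ S) (σ σ' : W ⟶ W) (c : ℂ),
        σ ≫ σ' = 𝟙 W ∧ σ' ≫ σ = 𝟙 W ∧
        (∀ z : complexBetti W (2 * 2), complexBetti.map σ (2 * 2) z = z) ∧
        (∀ z : complexBetti W (2 * 2), complexBetti.map σ' (2 * 2) z = z) ∧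
        (∀ x : complexBetti S (2 * 1), complexBetti.map π (2 * 1)
            (c • complexGysin μ hW hS.1 π (rfl : 2 * 1 + 2 * 2 = 2 * 1 + 2 * 2)
                  (complexBetti.map (σ ≫ π) (2 * 1) x) +
              c • complexGysin μ hW hS.1 π (rfl : 2 * 1 + 2 * 2 = 2 * 1 + 2 * 2)
                  (complexBetti.map (σ' ≫ π) (2 * 1) x)) =
            complexBetti.map (σ ≫ π) (2 * 1) x + complexBetti.map (σ' ≫ π) (2 * 1) x) ∧
        (∀ x : complexBetti S (2 * 1),
            c • complexGysin μ hW hS.1 π (rfl : 2 * 1 + 2 * 2 = 2 * 1 + 2 * 2)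
              (complexBetti.map π (2 * 1) x) = x) ∧
        (∀ y : complexBetti W (2 * 1), IsRationalClass y →
            IsRationalClass (c • complexGysin μ hW hS.1 π (rfl : 2 * 1 + 2 * 2 = 2 * 1 + 2 * 2) y)) ∧
        (∀ x : complexBetti S (2 * 1),
            (∀ d ∈ algebraicClasses S 1, cupProduct (rfl : 2 * 1 + 2 * 1 = 2 * 2) x d = 0) →
              complexBetti.map σ (2 * 1) (complexBetti.map σ (2 * 1) (complexBetti.map σ (2 * 1)
                (complexBetti.map σ (2 * 1) (complexBetti.map π (2 * 1) x)))) =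
                  -complexBetti.map π (2 * 1) x) := by
  sorry

/-- **Stub 6 · THE THEOREM OF THE LINE: an octagonal presentation gives the anchor** (reshape, lead c1,
cycle 1; proved in `Theorems/NikulinTwinTransportTwinTransportRMPicardTwoAnchorOfPresentation` from the four
landed stubs and `rmAnchor_at_of_realMultiplication_algebraic_at`).  Granted the two named facts
(`Huybrechts_K3_marking_exists`, `Grothendieck1969_supportedClasses_le_hodgeConiveau`): for every projective
K3 surface `S` of Picard rank `2` with the `e`-block and every octagonal presentation `(W, π, σ, σ', c)` of
it (the eight clauses of `stub_octagonalPresentation`), the conclusion of the crux holds at `S` — a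
projective K3 partner `S″` (namely `S` itself), a generator `p″` and an ALGEBRAIC `Ψ : H²(S″) ≃ H²(S)` with
rational, type-preserving, form-halving inverse.  [VanGeemenSchuett2023 §4.7–4.8; Fulton1998 §16.1;
Huybrechts2016K3 Ch. 3] -/
theorem stub_anchor_of_presentation : Huybrechts_K3_marking_exists →
    Grothendieck1969_supportedClasses_le_hodgeConiveau →
    ∀ (μ : OrientationFamily), μ.HasPoincareDuality →
    ∀ (S : SchemeOver ℂ)
      (hS : (IsSmoothProjective 2 S ∧ Subsingleton (structureSheafCohomology S.left 1) ∧
        ∃ (A : HodgeModel 2 S) (η : MForm 𝓘(ℝ, A.model) A.carrier ℂ 2),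
          IsHolomorphicInCharts η ∧ ∀ x, η x ≠ 0))
      (p : complexBetti S (2 * 2)),
      (IsIntegralClass p ∧ ∀ q : complexBetti S (2 * 2), IsIntegralClass q → ∃ n : ℤ, q = n • p) →
      Module.finrank ℂ ↥(algebraicClasses S 1) = 2 →
      ∀ (e : complexBetti S (2 * 1) →ₗ[ℂ] complexBetti S (2 * 1)),
      (∀ x, IsRationalClass x → IsRationalClass (e x)) →
      (∀ (i j : ℕ) x, IsOfHodgeType 2 S (2 * 1) i j x → IsOfHodgeType 2 S (2 * 1) i j (e x)) →
      (∀ d ∈ algebraicClasses S 1, e d = 0) →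
      (∀ x : complexBetti S (2 * 1),
          (∀ d ∈ algebraicClasses S 1, cupProduct (rfl : 2 * 1 + 2 * 1 = 2 * 2) x d = 0) →
            e (e x) = (2 : ℂ) • x) →
      ∀ (W : SchemeOver ℂ) (hW : IsSmoothProjective 2 W) (π : W ⟶ S) (σ σ' : W ⟶ W) (c : ℂ),
        σ ≫ σ' = 𝟙 W →
        σ' ≫ σ = 𝟙 W →
        (∀ z : complexBetti W (2 * 2), complexBetti.map σ (2 * 2) z = z) →
        (∀ z : complexBetti W (2 * 2), complexBetti.map σ' (2 * 2) z = z) →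
        (∀ x : complexBetti S (2 * 1), complexBetti.map π (2 * 1)
            (c • complexGysin μ hW hS.1 π (rfl : 2 * 1 + 2 * 2 = 2 * 1 + 2 * 2)
                  (complexBetti.map (σ ≫ π) (2 * 1) x) +
              c • complexGysin μ hW hS.1 π (rfl : 2 * 1 + 2 * 2 = 2 * 1 + 2 * 2)
                  (complexBetti.map (σ' ≫ π) (2 * 1) x)) =
            complexBetti.map (σ ≫ π) (2 * 1) x + complexBetti.map (σ' ≫ π) (2 * 1) x) →
        (∀ x : complexBetti S (2 * 1),
            c • complexGysin μ hW hS.1 π (rfl : 2 * 1 + 2 * 2 = 2 * 1 + 2 * 2)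
              (complexBetti.map π (2 * 1) x) = x) →
        (∀ y : complexBetti W (2 * 1), IsRationalClass y →
            IsRationalClass (c • complexGysin μ hW hS.1 π (rfl : 2 * 1 + 2 * 2 = 2 * 1 + 2 * 2) y)) →
        (∀ x : complexBetti S (2 * 1),
            (∀ d ∈ algebraicClasses S 1, cupProduct (rfl : 2 * 1 + 2 * 1 = 2 * 2) x d = 0) →
              complexBetti.map σ (2 * 1) (complexBetti.map σ (2 * 1) (complexBetti.map σ (2 * 1)
                (complexBetti.map σ (2 * 1) (complexBetti.map π (2 * 1) x)))) =
                  -complexBetti.map π (2 * 1) x) →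
        ∃ (S'' : SchemeOver ℂ)
          (hS'' : (IsSmoothProjective 2 S'' ∧ Subsingleton (structureSheafCohomology S''.left 1) ∧
            ∃ (A : HodgeModel 2 S'') (η : MForm 𝓘(ℝ, A.model) A.carrier ℂ 2),
              IsHolomorphicInCharts η ∧ ∀ x, η x ≠ 0))
          (p'' : complexBetti S'' (2 * 2)),
          (IsIntegralClass p'' ∧ ∀ q : complexBetti S'' (2 * 2), IsIntegralClass q → ∃ n : ℤ, q = n • p'') ∧
          ∃ Ψ : complexBetti S'' (2 * 1) ≃ₗ[ℂ] complexBetti S (2 * 1),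
            (∀ y, IsRationalClass y → IsRationalClass (Ψ.symm y)) ∧
            (∀ (i j : ℕ) y, IsOfHodgeType 2 S (2 * 1) i j y → IsOfHodgeType 2 S'' (2 * 1) i j (Ψ.symm y)) ∧
            (∀ (u v : complexBetti S (2 * 1)) (b : ℂ),
                cupProduct (rfl : 2 * 1 + 2 * 1 = 2 * 2) u v = ((2 : ℂ) * b) • p →
                  cupProduct (rfl : 2 * 1 + 2 * 1 = 2 * 2) (Ψ.symm u) (Ψ.symm v) = b • p'') ∧
            ∃ γ ∈ algebraicClasses (S ⊗ S'') 2, ∀ x : complexBetti S'' (2 * 1), Ψ x =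
              complexGysin μ (IsSmoothProjective.tensor_holds hS.1 hS''.1) hS.1 (fst S S'')
                (rfl : 2 * 1 + 2 * 2 + 2 * 2 = 2 * 1 + 2 * (2 + 2))
                (cupProduct (rfl : 2 * 1 + 2 * 2 = 2 * 1 + 2 * 2)
                  (complexBetti.map (snd S S'') (2 * 1) x) γ) := by
  sorry

/-! ## The composition (kernel-checked, no `sorry` below this line) -/

/-- **`TwinTransportRMPicardTwo_of`** — the glue of the line, now one line deep: the leaf facts (stub 4)
give the two named facts through their tree reductions; an octagonal presentation (stub 5, the heart)
fed to the theorem of the line (stub 6) is the conclusion of the crux, BY NAME. -/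
theorem TwinTransportRMPicardTwo_of
    (h₄ : K3_finrank_complexBetti_two ∧ K3_even_intersectionForm ∧
      K3_exists_orientation_signature_hodgeRiemann_ample ∧
      Deligne1974_ker_pullback_eq_ker_pullback_resolution)
    (h₅ : ∀ (μ : OrientationFamily), μ.HasPoincareDuality →
      ∀ (S : SchemeOver ℂ)
        (hS : (IsSmoothProjective 2 S ∧ Subsingleton (structureSheafCohomology S.left 1) ∧
          ∃ (A : HodgeModel 2 S) (η : MForm 𝓘(ℝ, A.model) A.carrier ℂ 2),
            IsHolomorphicInCharts η ∧ ∀ x, η x ≠ 0))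
        (p : complexBetti S (2 * 2)),
        (IsIntegralClass p ∧ ∀ q : complexBetti S (2 * 2), IsIntegralClass q → ∃ n : ℤ, q = n • p) →
        Module.finrank ℂ ↥(algebraicClasses S 1) = 2 →
        ∀ (e : complexBetti S (2 * 1) →ₗ[ℂ] complexBetti S (2 * 1)),
        (∀ x, IsRationalClass x → IsRationalClass (e x)) →
        (∀ (i j : ℕ) x, IsOfHodgeType 2 S (2 * 1) i j x → IsOfHodgeType 2 S (2 * 1) i j (e x)) →
        (∀ d ∈ algebraicClasses S 1, e d = 0) →
        (∀ x : complexBetti S (2 * 1),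
            (∀ d ∈ algebraicClasses S 1, cupProduct (rfl : 2 * 1 + 2 * 1 = 2 * 2) x d = 0) →
              e (e x) = (2 : ℂ) • x) →
        ∃ (W : SchemeOver ℂ) (hW : IsSmoothProjective 2 W) (π : W ⟶ S) (σ σ' : W ⟶ W) (c : ℂ),
          σ ≫ σ' = 𝟙 W ∧ σ' ≫ σ = 𝟙 W ∧
          (∀ z : complexBetti W (2 * 2), complexBetti.map σ (2 * 2) z = z) ∧
          (∀ z : complexBetti W (2 * 2), complexBetti.map σ' (2 * 2) z = z) ∧
          (∀ x : complexBetti S (2 * 1), complexBetti.map π (2 * 1)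
              (c • complexGysin μ hW hS.1 π (rfl : 2 * 1 + 2 * 2 = 2 * 1 + 2 * 2)
                    (complexBetti.map (σ ≫ π) (2 * 1) x) +
                c • complexGysin μ hW hS.1 π (rfl : 2 * 1 + 2 * 2 = 2 * 1 + 2 * 2)
                    (complexBetti.map (σ' ≫ π) (2 * 1) x)) =
              complexBetti.map (σ ≫ π) (2 * 1) x + complexBetti.map (σ' ≫ π) (2 * 1) x) ∧
          (∀ x : complexBetti S (2 * 1),
              c • complexGysin μ hW hS.1 π (rfl : 2 * 1 + 2 * 2 = 2 * 1 + 2 * 2)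
                (complexBetti.map π (2 * 1) x) = x) ∧
          (∀ y : complexBetti W (2 * 1), IsRationalClass y →
              IsRationalClass (c • complexGysin μ hW hS.1 π (rfl : 2 * 1 + 2 * 2 = 2 * 1 + 2 * 2) y)) ∧
          (∀ x : complexBetti S (2 * 1),
              (∀ d ∈ algebraicClasses S 1, cupProduct (rfl : 2 * 1 + 2 * 1 = 2 * 2) x d = 0) →
                complexBetti.map σ (2 * 1) (complexBetti.map σ (2 * 1) (complexBetti.map σ (2 * 1)
                  (complexBetti.map σ (2 * 1) (complexBetti.map π (2 * 1) x)))) =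
                    -complexBetti.map π (2 * 1) x))
    (h₆ : Huybrechts_K3_marking_exists →
      Grothendieck1969_supportedClasses_le_hodgeConiveau →
      ∀ (μ : OrientationFamily), μ.HasPoincareDuality →
      ∀ (S : SchemeOver ℂ)
        (hS : (IsSmoothProjective 2 S ∧ Subsingleton (structureSheafCohomology S.left 1) ∧
          ∃ (A : HodgeModel 2 S) (η : MForm 𝓘(ℝ, A.model) A.carrier ℂ 2),
            IsHolomorphicInCharts η ∧ ∀ x, η x ≠ 0))
        (p : complexBetti S (2 * 2)),
        (IsIntegralClass p ∧ ∀ q : complexBetti S (2 * 2), IsIntegralClass q → ∃ n : ℤ, q = n • p) →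
        Module.finrank ℂ ↥(algebraicClasses S 1) = 2 →
        ∀ (e : complexBetti S (2 * 1) →ₗ[ℂ] complexBetti S (2 * 1)),
        (∀ x, IsRationalClass x → IsRationalClass (e x)) →
        (∀ (i j : ℕ) x, IsOfHodgeType 2 S (2 * 1) i j x → IsOfHodgeType 2 S (2 * 1) i j (e x)) →
        (∀ d ∈ algebraicClasses S 1, e d = 0) →
        (∀ x : complexBetti S (2 * 1),
            (∀ d ∈ algebraicClasses S 1, cupProduct (rfl : 2 * 1 + 2 * 1 = 2 * 2) x d = 0) →
              e (e x) = (2 : ℂ) • x) →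
        ∀ (W : SchemeOver ℂ) (hW : IsSmoothProjective 2 W) (π : W ⟶ S) (σ σ' : W ⟶ W) (c : ℂ),
          σ ≫ σ' = 𝟙 W →
          σ' ≫ σ = 𝟙 W →
          (∀ z : complexBetti W (2 * 2), complexBetti.map σ (2 * 2) z = z) →
          (∀ z : complexBetti W (2 * 2), complexBetti.map σ' (2 * 2) z = z) →
          (∀ x : complexBetti S (2 * 1), complexBetti.map π (2 * 1)
              (c • complexGysin μ hW hS.1 π (rfl : 2 * 1 + 2 * 2 = 2 * 1 + 2 * 2)
                    (complexBetti.map (σ ≫ π) (2 * 1) x) +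
                c • complexGysin μ hW hS.1 π (rfl : 2 * 1 + 2 * 2 = 2 * 1 + 2 * 2)
                    (complexBetti.map (σ' ≫ π) (2 * 1) x)) =
              complexBetti.map (σ ≫ π) (2 * 1) x + complexBetti.map (σ' ≫ π) (2 * 1) x) →
          (∀ x : complexBetti S (2 * 1),
              c • complexGysin μ hW hS.1 π (rfl : 2 * 1 + 2 * 2 = 2 * 1 + 2 * 2)
                (complexBetti.map π (2 * 1) x) = x) →
          (∀ y : complexBetti W (2 * 1), IsRationalClass y →
              IsRationalClass (c • complexGysin μ hW hS.1 π (rfl : 2 * 1 + 2 * 2 = 2 * 1 + 2 * 2) y)) →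
          (∀ x : complexBetti S (2 * 1),
              (∀ d ∈ algebraicClasses S 1, cupProduct (rfl : 2 * 1 + 2 * 1 = 2 * 2) x d = 0) →
                complexBetti.map σ (2 * 1) (complexBetti.map σ (2 * 1) (complexBetti.map σ (2 * 1)
                  (complexBetti.map σ (2 * 1) (complexBetti.map π (2 * 1) x)))) =
                    -complexBetti.map π (2 * 1) x) →
          ∃ (S'' : SchemeOver ℂ)
            (hS'' : (IsSmoothProjective 2 S'' ∧ Subsingleton (structureSheafCohomology S''.left 1) ∧
              ∃ (A : HodgeModel 2 S'') (η : MForm 𝓘(ℝ, A.model) A.carrier ℂ 2),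
                IsHolomorphicInCharts η ∧ ∀ x, η x ≠ 0))
            (p'' : complexBetti S'' (2 * 2)),
            (IsIntegralClass p'' ∧ ∀ q : complexBetti S'' (2 * 2), IsIntegralClass q → ∃ n : ℤ, q = n • p'') ∧
            ∃ Ψ : complexBetti S'' (2 * 1) ≃ₗ[ℂ] complexBetti S (2 * 1),
              (∀ y, IsRationalClass y → IsRationalClass (Ψ.symm y)) ∧
              (∀ (i j : ℕ) y, IsOfHodgeType 2 S (2 * 1) i j y → IsOfHodgeType 2 S'' (2 * 1) i j (Ψ.symm y)) ∧
              (∀ (u v : complexBetti S (2 * 1)) (b : ℂ),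
                  cupProduct (rfl : 2 * 1 + 2 * 1 = 2 * 2) u v = ((2 : ℂ) * b) • p →
                    cupProduct (rfl : 2 * 1 + 2 * 1 = 2 * 2) (Ψ.symm u) (Ψ.symm v) = b • p'') ∧
              ∃ γ ∈ algebraicClasses (S ⊗ S'') 2, ∀ x : complexBetti S'' (2 * 1), Ψ x =
                complexGysin μ (IsSmoothProjective.tensor_holds hS.1 hS''.1) hS.1 (fst S S'')
                  (rfl : 2 * 1 + 2 * 2 + 2 * 2 = 2 * 1 + 2 * (2 + 2))
                  (cupProduct (rfl : 2 * 1 + 2 * 2 = 2 * 1 + 2 * 2)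
                    (complexBetti.map (snd S S'') (2 * 1) x) γ)) :
    Theses.NikulinTwinTransport.TwinTransportRMPicardTwo := by
  intro μ hμ S hS p hp hrank e he_rat he_type he_N he_T
  obtain ⟨h22, heven, hpos, h827⟩ := h₄
  have hmark : Huybrechts_K3_marking_exists :=
    Huybrechts_K3_marking_exists_holds_of h22 heven hpos
      (fun E _ _ _ M _ _ => Voisin2002_closedForm_top_zero_not_exact_holds E M)
      Huybrechts_K3_hodgeTypes_H2_holds hodgePQ_independent_of_hodgeModel_holds
      (fun E _ _ _ => Literature.NumberTheory.Transcendental.exists_deRhamIsoFamily_holds E)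
  have hG : Grothendieck1969_supportedClasses_le_hodgeConiveau :=
    Grothendieck1969_supportedClasses_le_hodgeConiveau_of_deligne
      (Deligne1974_ker_restrictCompl_eq_iSup_range_complexGysin_holds_of h827)
      (fun _ _ => nonempty_hodgeModel_holds)
      (fun E _ _ _ => Literature.NumberTheory.Transcendental.exists_deRhamIsoFamily_holds E)
  obtain ⟨W, hW, π, σ, σ', c, hσσ', hσ'σ, hσtop, hσ'top, h1, h2, hrat, h3⟩ :=
    h₅ μ hμ S hS p hp hrank e he_rat he_type he_N he_T
  exact h₆ hmark hG μ hμ S hS p hp hrank e he_rat he_type he_N he_T W hW π σ σ' c hσσ' hσ'σ hσtop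
    hσ'top h1 h2 hrat h3

/-- **The skeleton**: the crux modulo its registered stubs — the leaf-level named-fact debt
`stub_k3Facts`, the heart `stub_octagonalPresentation`, and the theorem of the line
`stub_anchor_of_presentation` (proved, awaiting the gate). -/
theorem TwinTransportRMPicardTwo_skeleton : Theses.NikulinTwinTransport.TwinTransportRMPicardTwo :=
  TwinTransportRMPicardTwo_of stub_k3Facts stub_octagonalPresentation stub_anchor_of_presentation

end Summit.HodgeConjecture.HodgeConjecture.Cruxes.TwinTransportRMPicardTwo.Sketch

end
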